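import Summits.QuantumFields.YangMills.Theorems.AllWindowsColdBoxBulkMidSandwichLocalisedDual

/-!
# The variance of the Stein remainder, LOCALISED to the core
# (crux idea `logconcave-core-extension` on ⟨stmt-QuantumFields-24006⟩ — toward a LOCALISED quadratic
# covariance comparison at the core constant `r_K`)

Whitened frame, `A ∈ C²(ℝⁿ)` with the global second-difference sandwich `(1 ± δ)|h|²` (`0 ≤ δ < 1`), a
measurable core `K` with the Hessian pinching `(1 ± δ_K)|v|²` (`0 ≤ δ_K < 1`), centring `∫ x_i e^{−A} = 0`;
`Z = ∫e^{−A}`, `P = ∫_{Kᶜ}e^{−A}`, `u = Hx + b`, `q = xᵀHx + b·x`, `R := ∂_uA − q` (the Stein remainder of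
the tree's ceiling, `…CeilingRemainder`).

`remainder_variance_le_localised` :
`(∫R²e^{−A})Z − (∫Re^{−A})² ≤ (1−δ)⁻¹·(2δ_K²∫|u|²e^{−A} + 2(δ²−δ_K²)∫_{Kᶜ}|u|²e^{−A}`
`                                   + 2 tr(H²)((1−δ_K)⁻¹δ_K²(Z−P) + (1−δ)⁻¹δ²P))·Z`
— the tree's `remainder_variance_le` with the pointwise defect `|D²A − 1| ≤ r(x)` read at the LOCAL constant
(`r = δ_K` on `K`, `δ` off `K`) and the localised score-defect second moment `phi_sq_le_localised`; the one
GLOBAL Brascamp–Lieb constant `(1−δ)⁻¹` multiplies a quantity that is already second order.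

HONEST SCOPE.  Free-hands work of the LEAD seat of ⟨stmt-QuantumFields-24006⟩ (FCL lineage) on an ingredient
of an UN-TRIAGED crux idea card; classical log-concave probability.  No stub of LINE-18, no crux, rung or
summit is proved; the Yang–Mills mass gap is NOT proved by any of this.
-/

noncomputable section

namespace Summit.QuantumFields.YangMills.Theorems.SandwichVariancePinching

open MeasureTheory Real Filter Topology Set
open Literature.Probability.Distributions (coordGradient coordHessian bl_wholeSpace_raw continuous_blQuad)
open Summit.QuantumFields.YangMills.Cruxes.TransportCovarianceTransfer (contDiff_quadObs fderiv_quadObs trace_mul_self_of_isSymm)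

variable {n : ℕ}

/-- **VARIANCE OF THE STEIN REMAINDER, LOCALISED** (`R := ∂_{Hx+b}A − q`):
`(∫R²e^{−A})Z − (∫Re^{−A})² ≤ (1−δ)⁻¹(2δ_K²∫|Hx+b|²e^{−A} + 2(δ²−δ_K²)∫_{Kᶜ}|Hx+b|²e^{−A}`
`  + 2tr(H²)((1−δ_K)⁻¹δ_K²(Z − ∫_{Kᶜ}e^{−A}) + (1−δ)⁻¹δ²∫_{Kᶜ}e^{−A}))·Z`. [folklore] -/
theorem remainder_variance_le_localised {A : (Fin n → ℝ) → ℝ} (hA : ContDiff ℝ 2 A) {δ : ℝ} (hδ : 0 ≤ δ)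
    (hδ1 : δ < 1)
    (hsw : ∀ x h : Fin n → ℝ, (1 - δ) * (h ⬝ᵥ h) ≤ A (x + h) + A (x - h) - 2 * A x ∧
      A (x + h) + A (x - h) - 2 * A x ≤ (1 + δ) * (h ⬝ᵥ h))
    (hcent : ∀ i : Fin n, ∫ x, x i * exp (-A x) = 0)
    {K : Set (Fin n → ℝ)} (hK : MeasurableSet K) {δK : ℝ} (hδK : 0 ≤ δK) (hδKδ : δK ≤ δ)
    (hloc : ∀ x ∈ K, ∀ v : Fin n → ℝ, (1 - δK) * (v ⬝ᵥ v) ≤ fderiv ℝ (fderiv ℝ A) x v v ∧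
      fderiv ℝ (fderiv ℝ A) x v v ≤ (1 + δK) * (v ⬝ᵥ v))
    {H : Matrix (Fin n) (Fin n) ℝ} (hH : H.IsSymm) (b : Fin n → ℝ) :
    (∫ x, (fderiv ℝ A x (H.mulVec x + b) - (x ⬝ᵥ H.mulVec x + b ⬝ᵥ x)) ^ 2 * exp (-A x)) * (∫ x, exp (-A x)) -
        (∫ x, (fderiv ℝ A x (H.mulVec x + b) - (x ⬝ᵥ H.mulVec x + b ⬝ᵥ x)) * exp (-A x)) ^ 2 ≤
      (1 - δ)⁻¹ * (2 * δK ^ 2 * (∫ x, ((H.mulVec x + b) ⬝ᵥ (H.mulVec x + b)) * exp (-A x)) +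
        2 * (δ ^ 2 - δK ^ 2) * (∫ x in Kᶜ, ((H.mulVec x + b) ⬝ᵥ (H.mulVec x + b)) * exp (-A x)) +
        2 * ((H * H).trace * ((1 - δK)⁻¹ * δK ^ 2 * ((∫ x, exp (-A x)) - ∫ x in Kᶜ, exp (-A x)) +
          (1 - δ)⁻¹ * δ ^ 2 * ∫ x in Kᶜ, exp (-A x)))) * ∫ x, exp (-A x) := by
  have hAc : Continuous A := hA.continuous
  obtain ⟨C₀, κ, _, hκ, hlb⟩ := exists_quadratic_lower_of_sandwich hAc hδ1 hsw
  have hZint : Integrable fun x => exp (-A x) := by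
    have := integrable_mul_exp_neg_of_growth hAc continuous_const hκ (by norm_num : 0 ≤ 8) hlb
      (w := fun _ => (1:ℝ)) (D := 1) (fun x => by simp)
    simpa using this
  have hZ : 0 < ∫ x, exp (-A x) := integral_exp_pos hZint
  have hδK1 : δK < 1 := lt_of_le_of_lt hδKδ hδ1
  set Z : ℝ := ∫ x, exp (-A x) with hZdef
  set P : ℝ := ∫ x in Kᶜ, exp (-A x) with hPdef
  set q : (Fin n → ℝ) → ℝ := fun x => x ⬝ᵥ H.mulVec x + b ⬝ᵥ x with hqdef
  have hqc1 : ContDiff ℝ 1 q := contDiff_quadObs H b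
  have hqd : ∀ x v, fderiv ℝ q x v = ((2:ℝ) • H.mulVec x + b) ⬝ᵥ v := fun x v => fderiv_quadObs hH b x v
  obtain ⟨Dq, Dq', hDq0, hDq'0, hqb, hq'b⟩ := quadObs_growth hH b
  set R : (Fin n → ℝ) → ℝ := fun x => fderiv ℝ A x (H.mulVec x + b) - q x with hRdef
  have hRc1 : ContDiff ℝ 1 R := (contDiff_fderiv_affine hA H b).sub hqc1
  obtain ⟨D₁, hD₁0, hD₁⟩ := exists_abs_fderiv_affine_le hA hδ hsw H b
  have hRb : ∀ x, |R x| ≤ (D₁ + Dq) * (1 + ‖x‖) ^ 3 := fun x => by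
    calc |R x| ≤ |fderiv ℝ A x (H.mulVec x + b)| + |q x| := abs_sub _ _
      _ ≤ D₁ * (1 + ‖x‖) ^ 3 + Dq * (1 + ‖x‖) ^ 3 := add_le_add (hD₁ x) (hqb x)
      _ = (D₁ + Dq) * (1 + ‖x‖) ^ 3 := by ring
  -- partials of `R`
  have hRd : ∀ x (j : Fin n), fderiv ℝ R x (Pi.single j 1) =
      (fderiv ℝ (fderiv ℝ A) x (Pi.single j 1) (H.mulVec x + b) - (H.mulVec x + b) j) +
        (fderiv ℝ A x (H.mulVec (Pi.single j 1)) - H.mulVec (Pi.single j 1) ⬝ᵥ x) := by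
    intro x j
    obtain ⟨L, hL, hLv⟩ := hasFDerivAt_fderiv_affine hA H b x
    have hqd' : HasFDerivAt q (fderiv ℝ q x) x := (hqc1.differentiable one_ne_zero x).hasFDerivAt
    have hR : HasFDerivAt R (L - fderiv ℝ q x) x := hL.sub hqd'
    rw [hR.fderiv, sub_apply, hLv, hqd]
    have e1 : H.mulVec (Pi.single j 1) ⬝ᵥ x = (H.mulVec x) j := by
      rw [show (H.mulVec x) j = H j ⬝ᵥ x from rfl, Matrix.mulVec_single_one]
      simp only [dotProduct, Matrix.col_apply]
      exact Finset.sum_congr rfl fun i _ => by rw [hH.apply i j]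
    rw [e1]
    simp only [dotProduct_single, mul_one, Pi.add_apply, Pi.smul_apply, smul_eq_mul]
    ring
  have hR'b : ∃ D : ℝ, ∀ x (j : Fin n), |fderiv ℝ R x (Pi.single j 1)| ≤ D * (1 + ‖x‖) ^ 2 := by
    have h := fun j : Fin n => exists_abs_fderiv_fderiv_affine_le hA hδ hsw H b (Pi.single j 1)
    choose Dj hDj0 hDj using h
    refine ⟨∑ j, Dj j + Dq', fun x j => ?_⟩
    have hLfd : fderiv ℝ R x (Pi.single j 1) = fderiv ℝ (fun y => fderiv ℝ A y (H.mulVec y + b)) x (Pi.single j 1)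
        - fderiv ℝ q x (Pi.single j 1) := by
      have hqd' : HasFDerivAt q (fderiv ℝ q x) x := (hqc1.differentiable one_ne_zero x).hasFDerivAt
      obtain ⟨L, hL, hLv⟩ := hasFDerivAt_fderiv_affine hA H b x
      have hR : HasFDerivAt R (L - fderiv ℝ q x) x := hL.sub hqd'
      rw [hR.fderiv, hL.fderiv, sub_apply]
    rw [hLfd]
    have h1 := hDj j x
    have h2 := hq'b x j
    have h3 : Dj j ≤ ∑ j, Dj j := Finset.single_le_sum (fun i _ => hDj0 i) (Finset.mem_univ j)
    calc |fderiv ℝ (fun y => fderiv ℝ A y (H.mulVec y + b)) x (Pi.single j 1) - fderiv ℝ q x (Pi.single j 1)|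
        ≤ Dj j * (1 + ‖x‖) ^ 2 + Dq' * (1 + ‖x‖) ^ 2 := (abs_sub _ _).trans (add_le_add h1 h2)
      _ ≤ (∑ j, Dj j + Dq') * (1 + ‖x‖) ^ 2 := by nlinarith [sq_nonneg (1 + ‖x‖)]
  obtain ⟨DR, hDR⟩ := hR'b
  -- the GLOBAL Brascamp–Lieb for `R` (its gradient is already second order)
  have hblR := bl_raw_of_sandwich hA hδ1 hsw hRc1 hRb hDR
  -- the pointwise gradient bound with the LOCAL defect constant `r` (`= δK` on `K`, `δ` off `K`)
  set φ : Fin n → (Fin n → ℝ) → ℝ := fun j x => fderiv ℝ A x (H.mulVec (Pi.single j 1)) -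
    H.mulVec (Pi.single j 1) ⬝ᵥ x with hφdef
  have hgradR : ∀ x (r : ℝ), (∀ v, |fderiv ℝ (fderiv ℝ A) x v v - v ⬝ᵥ v| ≤ r * (v ⬝ᵥ v)) →
      coordGradient R x ⬝ᵥ coordGradient R x ≤
        2 * (r ^ 2 * ((H.mulVec x + b) ⬝ᵥ (H.mulVec x + b))) + 2 * ∑ j, φ j x ^ 2 := by
    intro x r hr
    have hd := defect_sq_le_of_abs_hess hA x (H.mulVec x + b) hr
    simp only [dotProduct] at hd ⊢
    simp only [coordGradient, hRd, hφdef]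
    have hpt : ∀ a c : ℝ, (a + c) * (a + c) ≤ 2 * (a * a) + 2 * (c * c) := fun a c => by
      nlinarith [sq_nonneg (a - c)]
    calc ∑ j, (fderiv ℝ (fderiv ℝ A) x (Pi.single j 1) (H.mulVec x + b) - (H.mulVec x + b) j +
          (fderiv ℝ A x (H.mulVec (Pi.single j 1)) - H.mulVec (Pi.single j 1) ⬝ᵥ x)) *
          (fderiv ℝ (fderiv ℝ A) x (Pi.single j 1) (H.mulVec x + b) - (H.mulVec x + b) j +
          (fderiv ℝ A x (H.mulVec (Pi.single j 1)) - H.mulVec (Pi.single j 1) ⬝ᵥ x))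
        ≤ ∑ j, (2 * ((fderiv ℝ (fderiv ℝ A) x (Pi.single j 1) (H.mulVec x + b) - (H.mulVec x + b) j) *
            (fderiv ℝ (fderiv ℝ A) x (Pi.single j 1) (H.mulVec x + b) - (H.mulVec x + b) j)) +
            2 * ((fderiv ℝ A x (H.mulVec (Pi.single j 1)) - H.mulVec (Pi.single j 1) ⬝ᵥ x) *
            (fderiv ℝ A x (H.mulVec (Pi.single j 1)) - H.mulVec (Pi.single j 1) ⬝ᵥ x))) :=
          Finset.sum_le_sum fun j _ => hpt _ _
      _ = 2 * ∑ j, (fderiv ℝ (fderiv ℝ A) x (Pi.single j 1) (H.mulVec x + b) - (H.mulVec x + b) j) *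
            (fderiv ℝ (fderiv ℝ A) x (Pi.single j 1) (H.mulVec x + b) - (H.mulVec x + b) j) +
          2 * ∑ j, (fderiv ℝ A x (H.mulVec (Pi.single j 1)) - H.mulVec (Pi.single j 1) ⬝ᵥ x) ^ 2 := by
          rw [Finset.sum_add_distrib, Finset.mul_sum, Finset.mul_sum]
          congr 1
          exact Finset.sum_congr rfl fun j _ => by ring
      _ ≤ 2 * (r ^ 2 * ∑ j, (H.mulVec x + b) j * (H.mulVec x + b) j) +
          2 * ∑ j, (fderiv ℝ A x (H.mulVec (Pi.single j 1)) - H.mulVec (Pi.single j 1) ⬝ᵥ x) ^ 2 := by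
          linarith [hd]
  -- the localised score-defect second moments of the columns of `H`
  have hφ2 : ∀ j, ∫ x, φ j x ^ 2 * exp (-A x) ≤
      (H.mulVec (Pi.single j 1) ⬝ᵥ H.mulVec (Pi.single j 1)) *
        ((1 - δK)⁻¹ * δK ^ 2 * (Z - P) + (1 - δ)⁻¹ * δ ^ 2 * P) := fun j =>
    phi_sq_le_localised hA hδ hδ1 hsw hcent hK hδK1 hloc (H.mulVec (Pi.single j 1))
  have hHcols : ∑ j, H.mulVec (Pi.single j 1) ⬝ᵥ H.mulVec (Pi.single j 1) = (H * H).trace := by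
    rw [trace_mul_self_of_isSymm hH]
    simp only [Matrix.mulVec_single_one, dotProduct, Matrix.col_apply, sq]
    rw [Finset.sum_comm]
  have hIφ2 : ∀ j, Integrable fun x => φ j x ^ 2 * exp (-A x) := fun j => by
    obtain ⟨Kv, _, hKv⟩ := exists_abs_fderiv_le_of_sandwich hA hδ hsw (H.mulVec (Pi.single j 1))
    have hb1 : ∀ x, |φ j x| ≤ (Kv + ∑ i, |H.mulVec (Pi.single j 1) i|) * (1 + ‖x‖) ^ 3 := fun x => by
      have h1 := hKv x
      have h2 := abs_dotProduct_le_growth (H.mulVec (Pi.single j 1)) x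
      have hr : (1:ℝ) ≤ 1 + ‖x‖ := by linarith [norm_nonneg x]
      have hs : 0 ≤ ∑ i, |H.mulVec (Pi.single j 1) i| := Finset.sum_nonneg fun i _ => abs_nonneg _
      calc |φ j x| ≤ |fderiv ℝ A x (H.mulVec (Pi.single j 1))| + |H.mulVec (Pi.single j 1) ⬝ᵥ x| := abs_sub _ _
        _ ≤ Kv * (1 + ‖x‖) ^ 2 + (∑ i, |H.mulVec (Pi.single j 1) i|) * (1 + ‖x‖) ^ 1 := add_le_add h1 h2
        _ ≤ Kv * (1 + ‖x‖) ^ 3 + (∑ i, |H.mulVec (Pi.single j 1) i|) * (1 + ‖x‖) ^ 3 := by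
            nlinarith [pow_le_pow_right₀ hr (by norm_num : 2 ≤ 3), pow_le_pow_right₀ hr (by norm_num : 1 ≤ 3)]
        _ = (Kv + ∑ i, |H.mulVec (Pi.single j 1) i|) * (1 + ‖x‖) ^ 3 := by ring
    have := abs_mul_le_growth hb1 hb1
    refine integrable_mul_exp_neg_of_growth hAc ((contDiff_phi hA _).continuous.pow 2) hκ (by norm_num : 3 + 3 ≤ 8)
      hlb (D := (Kv + ∑ i, |H.mulVec (Pi.single j 1) i|) * (Kv + ∑ i, |H.mulVec (Pi.single j 1) i|))
      (fun x => ?_)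
    rw [sq]; exact this x
  obtain ⟨Cu, hCu0, hCu⟩ := exists_norm_affine_le H b
  have hn : (0:ℝ) ≤ n := Nat.cast_nonneg n
  have huu0 : ∀ x, 0 ≤ (H.mulVec x + b) ⬝ᵥ (H.mulVec x + b) := fun x => by
    simpa using dotProduct_self_star_nonneg (H.mulVec x + b)
  have hIuuI : Integrable fun x => ((H.mulVec x + b) ⬝ᵥ (H.mulVec x + b)) * exp (-A x) := by
    refine integrable_mul_exp_neg_of_growth hAc (((contDiff_affine H b).continuous).dotProduct
      (contDiff_affine H b).continuous) hκ (by norm_num : 2 ≤ 8) hlb (D := (n : ℝ) * Cu ^ 2) fun x => ?_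
    rw [abs_of_nonneg (huu0 x)]
    have h3 : ‖H.mulVec x + b‖ ^ 2 ≤ Cu ^ 2 * (1 + ‖x‖) ^ 2 := by
      rw [← mul_pow]; exact pow_le_pow_left₀ (norm_nonneg _) (hCu x) 2
    nlinarith [dotProduct_self_le_card_mul_norm_sq (H.mulVec x + b), mul_le_mul_of_nonneg_left h3 hn]
  -- the dominating function, two-level
  set g : (Fin n → ℝ) → ℝ := fun x => (2 * δK ^ 2) * (((H.mulVec x + b) ⬝ᵥ (H.mulVec x + b)) * exp (-A x)) +
    (2 * (δ ^ 2 - δK ^ 2)) * Kᶜ.indicator (fun x => ((H.mulVec x + b) ⬝ᵥ (H.mulVec x + b)) * exp (-A x)) x +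
    2 * ∑ j, φ j x ^ 2 * exp (-A x) with hgdef
  have hIsum : Integrable fun x => ∑ j, φ j x ^ 2 * exp (-A x) := integrable_finsetSum _ fun j _ => hIφ2 j
  have hgI : Integrable g :=
    ((hIuuI.const_mul _).add ((hIuuI.indicator hK.compl).const_mul _)).add (hIsum.const_mul 2)
  have hδK2 : δK ^ 2 ≤ δ ^ 2 := pow_le_pow_left₀ hδK hδKδ 2
  -- pointwise: `|∇R|² e^{−A} ≤ g`
  have hpt : ∀ x, (coordGradient R x ⬝ᵥ coordGradient R x) * exp (-A x) ≤ g x := by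
    intro x
    have he := (exp_pos (-A x)).le
    have hq := huu0 x
    have esum : ∀ r : ℝ, (2 * (r ^ 2 * ((H.mulVec x + b) ⬝ᵥ (H.mulVec x + b))) + 2 * ∑ j, φ j x ^ 2) * exp (-A x) =
        (2 * r ^ 2) * (((H.mulVec x + b) ⬝ᵥ (H.mulVec x + b)) * exp (-A x)) + 2 * ∑ j, φ j x ^ 2 * exp (-A x) := by
      intro r
      rw [add_mul, mul_assoc 2 (∑ j, φ j x ^ 2) (exp (-A x)), Finset.sum_mul]; ring
    by_cases hx : x ∈ K
    · have h := mul_le_mul_of_nonneg_right (hgradR x δK (abs_hess_sub_self_le_of_pinch (hloc x hx))) he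
      have hxc : x ∉ Kᶜ := fun h' => h' hx
      rw [esum δK] at h
      simp only [hgdef, indicator_of_notMem hxc, mul_zero, add_zero]
      exact h
    · have h := mul_le_mul_of_nonneg_right (hgradR x δ (abs_hess_sub_self_le hA hsw x)) he
      have hxc : x ∈ Kᶜ := hx
      rw [esum δ] at h
      simp only [hgdef, indicator_of_mem hxc]
      have e : (2 * δK ^ 2) * (((H.mulVec x + b) ⬝ᵥ (H.mulVec x + b)) * exp (-A x)) +
          (2 * (δ ^ 2 - δK ^ 2)) * (((H.mulVec x + b) ⬝ᵥ (H.mulVec x + b)) * exp (-A x)) +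
          2 * ∑ j, φ j x ^ 2 * exp (-A x) =
          (2 * δ ^ 2) * (((H.mulVec x + b) ⬝ᵥ (H.mulVec x + b)) * exp (-A x)) + 2 * ∑ j, φ j x ^ 2 * exp (-A x) := by
        ring
      rw [e]; exact h
  have hgradRI : Integrable fun x => (coordGradient R x ⬝ᵥ coordGradient R x) * exp (-A x) := by
    refine hgI.mono' (((Literature.Probability.Distributions.continuous_coordGradient hRc1).dotProduct
      (Literature.Probability.Distributions.continuous_coordGradient hRc1)).mul
      (continuous_exp.comp hAc.neg)).aestronglyMeasurable (ae_of_all _ fun x => ?_)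
    rw [Real.norm_eq_abs, abs_of_nonneg (mul_nonneg (by simpa using dotProduct_self_star_nonneg (coordGradient R x))
      (exp_pos _).le)]
    exact hpt x
  have hmono : ∫ x, (coordGradient R x ⬝ᵥ coordGradient R x) * exp (-A x) ≤ ∫ x, g x :=
    integral_mono hgradRI hgI hpt
  have hgint : ∫ x, g x = (2 * δK ^ 2) * (∫ x, ((H.mulVec x + b) ⬝ᵥ (H.mulVec x + b)) * exp (-A x)) +
      (2 * (δ ^ 2 - δK ^ 2)) * (∫ x in Kᶜ, ((H.mulVec x + b) ⬝ᵥ (H.mulVec x + b)) * exp (-A x)) +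
      2 * ∑ j, ∫ x, φ j x ^ 2 * exp (-A x) := by
    have h1 : Integrable fun x => (2 * δK ^ 2) * (((H.mulVec x + b) ⬝ᵥ (H.mulVec x + b)) * exp (-A x)) :=
      hIuuI.const_mul _
    have h2 : Integrable fun x => (2 * (δ ^ 2 - δK ^ 2)) *
        Kᶜ.indicator (fun x => ((H.mulVec x + b) ⬝ᵥ (H.mulVec x + b)) * exp (-A x)) x :=
      (hIuuI.indicator hK.compl).const_mul _
    have h12 : Integrable fun x => (2 * δK ^ 2) * (((H.mulVec x + b) ⬝ᵥ (H.mulVec x + b)) * exp (-A x)) +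
        (2 * (δ ^ 2 - δK ^ 2)) * Kᶜ.indicator (fun x => ((H.mulVec x + b) ⬝ᵥ (H.mulVec x + b)) * exp (-A x)) x :=
      h1.add h2
    have h3 : Integrable fun x => 2 * ∑ j, φ j x ^ 2 * exp (-A x) := hIsum.const_mul 2
    simp only [hgdef]
    rw [integral_add h12 h3, integral_add h1 h2, integral_const_mul, integral_const_mul, integral_const_mul,
      integral_indicator hK.compl, integral_finsetSum _ (fun j _ => hIφ2 j)]
  have hsum : ∑ j, ∫ x, φ j x ^ 2 * exp (-A x) ≤
      (H * H).trace * ((1 - δK)⁻¹ * δK ^ 2 * (Z - P) + (1 - δ)⁻¹ * δ ^ 2 * P) := by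
    calc ∑ j, ∫ x, φ j x ^ 2 * exp (-A x)
        ≤ ∑ j, (H.mulVec (Pi.single j 1) ⬝ᵥ H.mulVec (Pi.single j 1)) *
            ((1 - δK)⁻¹ * δK ^ 2 * (Z - P) + (1 - δ)⁻¹ * δ ^ 2 * P) := Finset.sum_le_sum fun j _ => hφ2 j
      _ = (H * H).trace * ((1 - δK)⁻¹ * δK ^ 2 * (Z - P) + (1 - δ)⁻¹ * δ ^ 2 * P) := by
          rw [← hHcols, Finset.sum_mul]
  have hgradRint : ∫ x, (coordGradient R x ⬝ᵥ coordGradient R x) * exp (-A x) ≤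
      2 * δK ^ 2 * (∫ x, ((H.mulVec x + b) ⬝ᵥ (H.mulVec x + b)) * exp (-A x)) +
        2 * (δ ^ 2 - δK ^ 2) * (∫ x in Kᶜ, ((H.mulVec x + b) ⬝ᵥ (H.mulVec x + b)) * exp (-A x)) +
        2 * ((H * H).trace * ((1 - δK)⁻¹ * δK ^ 2 * (Z - P) + (1 - δ)⁻¹ * δ ^ 2 * P)) := by
    rw [hgint] at hmono
    linarith
  have hinv : 0 ≤ (1 - δ)⁻¹ := inv_nonneg.mpr (by linarith)
  exact hblR.trans (mul_le_mul_of_nonneg_right (mul_le_mul_of_nonneg_left hgradRint hinv) hZ.le)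

end Summit.QuantumFields.YangMills.Theorems.SandwichVariancePinching

end
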